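import Literature.Probability.Percolation.ArmSeparationExtSlotPairs
import Literature.Probability.Percolation.ArmSeparationExtLandingGlue
import Literature.Probability.Percolation.ArmSeparationMove
import HarnessLib

/-!
# The landing move of an outer tip

Topic: Probability / Percolation; family `crit-perc`. A brick of the discharge of
`Literature.Probability.Percolation.Nolin2008_twoArm_separation` (Nolin 2008, Thm. 11
[arXiv 0711.4948: Thm. 10]; `ArmSeparation.lean`), landing of the EXTERNAL extremities (mirror of
`landing_move` of `ArmSeparationMove.lean`): a fenced outer tip of the frame `ρ^i` whose spoke,
ring arc and four landing strips are crossed yields an open arm landed on `∂Λ_N`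
(`ext_landing_move`): the hook `trapArm_to_entry` carries the arm from its start through the fence
and the spoke into the entry piece of the ring, and `ext_landing_glue` carries it along the arc,
the approach strip and the strips of the target corner onto the fence line `x = N + 1`.

## References

* P. Nolin, *Near-critical percolation in two dimensions*, Electron. J. Probab. 13 (2008), §4.3
  Prop. 12, §4.4 [arXiv 0711.4948: Prop. 11, Thm. 10 (external extremities)]. [Nolin2008]
-/

noncomputable section

open Set

namespace Literature.Probability.Percolation

open LatticeModels Tube

/-- **The landing move of an outer tip.** A fenced outer tip `F` of the frame `i` (configuration
`rotConfig i ω`) in the window `[T₀, T₀ + w')`, the spoke of its slot crossed, a ring arc all of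
whose tubes are crossed with the spoke meeting the arc's tube `Te`, the exit run `V_{j₀..j₀+d}` of
the arc across the rows `[t, t + r/64]`, the approach strip and the three strips of the target
corner crossed, and the size conditions keeping every piece inside the annulus `{n ≤ |v| ≤ N}`.
Then `ω ∈ extOpenArm n N`. [cite: Nolin2008, §4.3 Prop. 12 and §4.4 (arXiv 0711.4948: Prop. 11, Thm. 10)] -/
theorem ext_landing_move {M n N k₀ K : ℕ} {i : ℕ} (hi : i < 6) {ω : SiteConfig (Site 2)}
    (F : TrapFencedArm M n k₀ K (rotConfig i ω))
    {T₀ : ℤ} {w' : ℕ} (hwin : T₀ ≤ F.z 1 ∧ F.z 1 < T₀ + w') {L ε : ℕ} (hfit : (w' : ℤ) + (F.k / 4 : ℕ) + 2 * ε ≤ F.k)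
    (hL : F.k + 1 ≤ L) (hSp : ω ∈ extSpokeEvent i M F.k T₀ w' L ε)
    {r e s a len : ℕ} (hs : 1 ≤ s) (hsr : s ∣ r) (hsr' : s ≤ r) (he : 2 * e ≤ r)
    (harc : ω ∈ eventAll (arc (thinRing r e s) a len))
    {Te : Tube} (hTe : Te ∈ arc (thinRing r e s) a len) (hJ : SpokeMeetsRot i (extSpokeTube M F.k T₀ w' L ε) Te)
    {j₀ d : ℕ} (hSL : ∀ T ∈ vchunks r (-(r : ℤ)) e s j₀ (d + 1), T ∈ arc (thinRing r e s) a len)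
    {t : ℤ} (hlo : -(r : ℤ) + j₀ * s - e ≤ t) (hhi : t + (r / 64 : ℕ) ≤ -(r : ℤ) + (j₀ + d) * s - e)
    {W H : ℕ} (hW : (r : ℤ) - e - 1 + W = N - 1) (hH : -((N / 2 : ℕ) : ℤ) - (N / 64 : ℕ) + H = t + (r / 64 : ℕ))
    (h2 : ω ∈ extE2 r e t W) (h3 : ω ∈ extE3 N H) (h4 : ω ∈ extE4 N) (h5 : ω ∈ extE5 N)
    (hN : 128 ≤ N) (hnN : 2 * n ≤ N) (hnr : (n : ℤ) + s + 2 * e ≤ r) (hrN : (r : ℤ) + 2 * e ≤ (N : ℤ) - (N / 8 : ℕ))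
    (htlo : -((N / 2 : ℕ) : ℤ) ≤ t) (hthi : t + (r / 64 : ℕ) ≤ 0)
    (hnM : n ≤ M) (hkL : 2 * (M : ℤ) + F.k + L ≤ N) (hT₀ : -(2 * (M : ℤ)) ≤ T₀) (hT₀' : T₀ + w' + 2 * F.k ≤ 0)
    (hkM : (n : ℤ) + 2 * F.k + 1 ≤ 2 * M) (hMN : 2 * (M : ℤ) + 4 * F.k + 2 ≤ N) (hz1 : F.z 1 + 2 * F.k ≤ 0) :
    ω ∈ extOpenArm n N := by
  obtain ⟨hz0, hz1lo, -⟩ := trapO_coord F.z_mem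
  -- the arc as a nonempty chain with prescribed crossings
  obtain ⟨E, L', hEL⟩ := List.exists_cons_of_ne_nil (List.ne_nil_of_mem hTe)
  have harc' : ∀ T ∈ E :: L', ω ∈ T.event := fun T hT => harc T (hEL ▸ hT)
  have hch : List.IsChain Crosses (E :: L') := hEL ▸ isChain_arc_thinRing hs hsr hsr' a len
  obtain ⟨X, Y, hXY⟩ := exists_crossings harc'
  have hTe' : Te ∈ E :: L' := hEL ▸ hTe
  have hring : ∀ T ∈ E :: L', T ∈ thinRing r e s := fun T hT => mem_of_mem_arc (hEL ▸ hT : T ∈ arc (thinRing r e s) a len)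
  have hLreg : ∀ T ∈ E :: L', T.box ⊆ triAnnulusSet n N := fun T hT v hv => by
    have := triNorm_mem_of_mem_thinRing he (hring T hT) hv
    rw [mem_triAnnulusSet]; constructor <;> omega
  -- the hook
  have P₁ := trapArm_to_entry hi F hwin hfit hL hSp (hXY Te hTe') hJ
  -- everything lies in the annulus
  have hreg : (triRotIsoPow i '' ((extSpokeTube M F.k T₀ w' L ε).box ∪
      (triAnnSet n (2 * M) ∪ trapFrameZone M F.z F.k ∪ triStrip (F.z 0 + F.k) (F.z 1 + F.k) F.k F.k)) ∪ Te.box) ⊆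
      triAnnulusSet n N ∪ triOpenBall ![(N : ℤ), -((N / 2 : ℕ) : ℤ)] (N / 8) := by
    rintro v (⟨u, hu, rfl⟩ | hv)
    · left
      rw [mem_triAnnulusSet, triNorm_rot]
      rcases hu with hu | (hu | hu) | hu
      · rw [Tube.mem_box] at hu; simp only [extSpokeTube] at hu
        have hk4 : (0 : ℤ) ≤ (F.k / 4 : ℕ) := by positivity
        have hn : triNorm u = u 0 :=
          le_antisymm (triNorm_le_iff_lin.2 (by omega)) (le_triNorm_iff_lin.2 (Or.inl le_rfl))
        rw [hn]; constructor <;> omega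
      · rw [mem_triAnnSet] at hu; exact ⟨hu.1, by omega⟩
      · rw [mem_trapFrameZone] at hu
        obtain ⟨h1, h2, h3, h4, h5⟩ := hu
        rcases h1 with h1 | h1
        · rw [mem_trapD_iff_triNorm] at h1
          exact ⟨(le_triNorm_iff_lin.2 (Or.inl (by omega))), by omega⟩
        · constructor
          · exact le_trans (by omega) h1.1.le
          · exact triNorm_le_iff_lin.2 (by omega)
      · rw [mem_triStrip] at hu
        constructor
        · exact le_triNorm_iff_lin.2 (Or.inl (by omega))
        · exact triNorm_le_iff_lin.2 (by omega)
    · exact Or.inl (hLreg Te hTe' hv)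
  -- glue
  exact ext_landing_glue (a := triRotIsoPow i F.a) (by rw [triNorm_rot]; exact F.norm_a) hch hXY hLreg hreg hTe' P₁
    (fun T hT => hEL ▸ hSL T hT) hlo hhi hW hH h2 h3 h4 h5 hN hnN (by omega) (by omega) (by omega) htlo hthi

end Literature.Probability.Percolation
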